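import Summits.CriticalPhenomena.Ising3DConformalLimit.Theses.LogPolarProxy
import Summits.CriticalPhenomena.Ising3DConformalLimit.Theorems.LogPolarProxyProxyUniversalityLatticeForm
import HarnessLib

/-!
# Strategist census — crux `ProxyUniversality` (stmt-CriticalPhenomena-11288), typed artefacts

Route `LogPolarProxy`, sub-problem `Ising3DConformalLimit`. Companion of `STRATEGY-CENSUS.md`
(crux dir, same commit). This file holds the TYPED objects the census refers to; it proves only
logic / elementary limit algebra and carries no `sorry`:

* `LatticeComparison` — the registered stub `LC_pin` of `Lines/birth.lean` v4.1 VERBATIM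
  (`latticeComparison_iff_registered : … ↔ <stub signature> := Iff.rfl`), written over the
  fixed-profile, fixed-order slice `LCAt Jr Jt Jp A n`.
* `## Decomposition`: the best typed split `TwoPointComparison` (the `n = 2` slice, one profile) +
  `Propagation` (for every admissible profile, the `n = 2` comparison propagates to every even
  order) with the assembly `ProxyUniversality_of_subs : TwoPointComparison → Propagation →
  ProxyUniversality` PROVED (via the landed `ProxyUniversality_of_latticeComparison`), and the weakest
  second piece `PropagationBridge := TwoPointComparison → LatticeComparison` (modus-ponens split).
  `twoPointComparison_of_latticeComparison` records that `Sub₁` is a WEAKENING of the stub.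
* `## Strengthen`: `RateLatticeComparison` (`LC_pin` with a power rate `C·(N+1)^{-α}` on compacts) and
  `latticeComparison_of_rate : RateLatticeComparison → LatticeComparison` (so `S⁺` feeds `closes`
  through the registered composition).
* `## Negation`: `RadialEndsIrrelevance` — the (unproved, limit-free) hypothesis under which the
  `n = 2` comparison forces asymptotic scale-covariance of the pinned `ℤ³` two-point function; typed
  here only so the census can name it exactly.

Nothing here is registered as a line (strategist verdict: no switch has teeth — see the census).
-/

noncomputable section

namespace Summit.CriticalPhenomena.Ising3DConformalLimit.Cruxes.ProxyUniversality.Strategist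

open scoped BigOperators Topology
open Filter Set Function
open Literature.Probability.LatticeModels
open Summit.CriticalPhenomena.Ising3DConformalLimit.Theses.LogPolarProxy (ProxyUniversality)
open Summit.CriticalPhenomena.Ising3DConformalLimit.Cruxes.ProxyUniversality.Birth

/-! ## §0 The registered stub, sliced by profile and order -/

/-- `LCAt J A n`: the order-`n` lattice comparison in the pinned gauge for ONE fixed profile
`(J_r, J_θ, J_φ, A)` — renormalised proxy `n`-point function minus rescaled critical `ℤ³` `n`-point
function at mesh `δ_N = π/(N+1)` tends to `0` locally uniformly on injective off-axis configurations. -/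
def LCAt (Jr Jt Jp : ℕ → ℕ → ℝ) (A : ℕ → ℝ → ℝ) (n : ℕ) : Prop :=
  TendstoLocallyUniformlyOn
    (fun (N : ℕ) (p : Fin n → EuclideanSpace ℝ (Fin 3)) =>
      proxyCorr Jr Jt Jp A
          (fun δ : ℝ => (criticalTwoPoint 3 (Pi.single 0 (⌊1 / δ⌋ : ℤ))) ^ (-(1 / 2 : ℝ))) N n p -
        rescaledCorrelator (criticalCorr 3)
          (fun δ : ℝ => (criticalTwoPoint 3 (Pi.single 0 (⌊1 / δ⌋ : ℤ))) ^ (-(1 / 2 : ℝ))) n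
          (Real.pi / ((N : ℝ) + 1)) p)
    (fun _ => 0) atTop (offAxis n)

/-- `LC_pin`, the registered stub `stub_latticeComparison` of `Lines/birth.lean` (v4.1). -/
def LatticeComparison : Prop :=
  ∃ (Jr Jt Jp : ℕ → ℕ → ℝ) (A : ℕ → ℝ → ℝ), (∀ N j, 0 ≤ Jr N j ∧ 0 ≤ Jt N j ∧ 0 ≤ Jp N j) ∧
    (∀ N θ, 0 < A N θ) ∧ ∀ n : ℕ, Even n → n ≠ 0 → LCAt Jr Jt Jp A n

/-- `LatticeComparison` is the registered stub signature, verbatim (definitional). -/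
theorem latticeComparison_iff_registered :
    LatticeComparison ↔
      ∃ (Jr Jt Jp : ℕ → ℕ → ℝ) (A : ℕ → ℝ → ℝ), (∀ N j, 0 ≤ Jr N j ∧ 0 ≤ Jt N j ∧ 0 ≤ Jp N j) ∧
        (∀ N θ, 0 < A N θ) ∧
        ∀ n : ℕ, Even n → n ≠ 0 →
          TendstoLocallyUniformlyOn
            (fun (N : ℕ) (p : Fin n → EuclideanSpace ℝ (Fin 3)) =>
              proxyCorr Jr Jt Jp A
                  (fun δ : ℝ => (criticalTwoPoint 3 (Pi.single 0 (⌊1 / δ⌋ : ℤ))) ^ (-(1 / 2 : ℝ))) N n p -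
                rescaledCorrelator (criticalCorr 3)
                  (fun δ : ℝ => (criticalTwoPoint 3 (Pi.single 0 (⌊1 / δ⌋ : ℤ))) ^ (-(1 / 2 : ℝ))) n
                  (Real.pi / ((N : ℝ) + 1)) p)
            (fun _ => 0) atTop (offAxis n) :=
  Iff.rfl

/-- The registered composition, restated over `LatticeComparison`. -/
theorem ProxyUniversality_of_latticeComparison' (h : LatticeComparison) : ProxyUniversality :=
  ProxyUniversality_of_latticeComparison h

/-! ## §1 Decomposition: `TwoPointComparison` + `Propagation` -/

/-- **Sub₁ (`n = 2` slice).** Some admissible profile reproduces the critical `ℤ³` TWO-point function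
in the pinned gauge, locally uniformly off the axis (all radii ratios and angles — not only same-ray). -/
def TwoPointComparison : Prop :=
  ∃ (Jr Jt Jp : ℕ → ℕ → ℝ) (A : ℕ → ℝ → ℝ), (∀ N j, 0 ≤ Jr N j ∧ 0 ≤ Jt N j ∧ 0 ≤ Jp N j) ∧
    (∀ N θ, 0 < A N θ) ∧ LCAt Jr Jt Jp A 2

/-- **Sub₂ (propagation, same profile).** For EVERY admissible profile: if it reproduces the two-point
function then it reproduces every even `n`-point function. -/
def Propagation : Prop :=
  ∀ (Jr Jt Jp : ℕ → ℕ → ℝ) (A : ℕ → ℝ → ℝ), (∀ N j, 0 ≤ Jr N j ∧ 0 ≤ Jt N j ∧ 0 ≤ Jp N j) →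
    (∀ N θ, 0 < A N θ) → LCAt Jr Jt Jp A 2 → ∀ n : ℕ, Even n → n ≠ 0 → LCAt Jr Jt Jp A n

/-- **Sub₂' (weakest second piece, modus-ponens split).** -/
def PropagationBridge : Prop := TwoPointComparison → LatticeComparison

/-- Glue of the split: `Sub₁ → Sub₂ → LC_pin` (pure logic). -/
theorem latticeComparison_of_subs (h1 : TwoPointComparison) (h2 : Propagation) : LatticeComparison := by
  obtain ⟨Jr, Jt, Jp, A, hJ, hA, h2pt⟩ := h1
  exact ⟨Jr, Jt, Jp, A, hJ, hA, h2 Jr Jt Jp A hJ hA h2pt⟩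

/-- **Assembly of the split, concluding the crux BY NAME:** `Sub₁ → Sub₂ → ProxyUniversality`. -/
theorem ProxyUniversality_of_subs : TwoPointComparison → Propagation → ProxyUniversality :=
  fun h1 h2 => ProxyUniversality_of_latticeComparison (latticeComparison_of_subs h1 h2)

/-- `Propagation` implies the bridge form. -/
theorem propagationBridge_of_propagation (h : Propagation) : PropagationBridge :=
  fun h1 => latticeComparison_of_subs h1 h

/-- Assembly of the modus-ponens split: `Sub₁ → Sub₂' → ProxyUniversality`. -/
theorem ProxyUniversality_of_bridge : TwoPointComparison → PropagationBridge → ProxyUniversality :=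
  fun h1 h2 => ProxyUniversality_of_latticeComparison (h2 h1)

/-- `Sub₁` is a weakening of the stub (the `n = 2` instance). -/
theorem twoPointComparison_of_latticeComparison (h : LatticeComparison) : TwoPointComparison := by
  obtain ⟨Jr, Jt, Jp, A, hJ, hA, hall⟩ := h
  exact ⟨Jr, Jt, Jp, A, hJ, hA, hall 2 even_two two_ne_zero⟩

/-- Hence the bridge piece is implied by the stub as well (it is the stub, given `Sub₁`). -/
theorem propagationBridge_of_latticeComparison (h : LatticeComparison) : PropagationBridge :=
  fun _ => h

/-! ## §2 Strengthen: a power-rate form `S⁺` and `S⁺ → LC_pin` -/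

/-- **`S⁺` (rate form).** As `LC_pin`, but on every compact off-axis set the difference is eventually
bounded by `C · (N+1)^{-α}` for some `C` and some `α > 0` (depending on `n` and the compact). -/
def RateLatticeComparison : Prop :=
  ∃ (Jr Jt Jp : ℕ → ℕ → ℝ) (A : ℕ → ℝ → ℝ), (∀ N j, 0 ≤ Jr N j ∧ 0 ≤ Jt N j ∧ 0 ≤ Jp N j) ∧
    (∀ N θ, 0 < A N θ) ∧
    ∀ n : ℕ, Even n → n ≠ 0 → ∀ K ⊆ offAxis n, IsCompact K →
      ∃ (C α : ℝ), 0 < α ∧ ∀ᶠ N : ℕ in atTop, ∀ p ∈ K,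
        |proxyCorr Jr Jt Jp A
              (fun δ : ℝ => (criticalTwoPoint 3 (Pi.single 0 (⌊1 / δ⌋ : ℤ))) ^ (-(1 / 2 : ℝ))) N n p -
            rescaledCorrelator (criticalCorr 3)
              (fun δ : ℝ => (criticalTwoPoint 3 (Pi.single 0 (⌊1 / δ⌋ : ℤ))) ^ (-(1 / 2 : ℝ))) n
              (Real.pi / ((N : ℝ) + 1)) p| ≤ C * ((N : ℝ) + 1) ^ (-α)

/-- A power rate on compacts gives locally uniform convergence on the open set `offAxis n`. -/
theorem lcAt_of_rate {Jr Jt Jp : ℕ → ℕ → ℝ} {A : ℕ → ℝ → ℝ} {n : ℕ}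
    (h : ∀ K ⊆ offAxis n, IsCompact K →
      ∃ (C α : ℝ), 0 < α ∧ ∀ᶠ N : ℕ in atTop, ∀ p ∈ K,
        |proxyCorr Jr Jt Jp A
              (fun δ : ℝ => (criticalTwoPoint 3 (Pi.single 0 (⌊1 / δ⌋ : ℤ))) ^ (-(1 / 2 : ℝ))) N n p -
            rescaledCorrelator (criticalCorr 3)
              (fun δ : ℝ => (criticalTwoPoint 3 (Pi.single 0 (⌊1 / δ⌋ : ℤ))) ^ (-(1 / 2 : ℝ))) n
              (Real.pi / ((N : ℝ) + 1)) p| ≤ C * ((N : ℝ) + 1) ^ (-α)) :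
    LCAt Jr Jt Jp A n := by
  unfold LCAt
  rw [tendstoLocallyUniformlyOn_iff_forall_isCompact (isOpen_offAxis n)]
  intro K hK hKc
  obtain ⟨C, α, hα, hN⟩ := h K hK hKc
  rw [Metric.tendstoUniformlyOn_iff]
  intro ε hε
  have h1 : Tendsto (fun N : ℕ => ((N : ℝ) + 1)) atTop atTop :=
    tendsto_atTop_add_const_right _ 1 tendsto_natCast_atTop_atTop
  have h2 : Tendsto (fun N : ℕ => C * ((N : ℝ) + 1) ^ (-α)) atTop (𝓝 (C * 0)) :=
    ((tendsto_rpow_neg_atTop hα).comp h1).const_mul C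
  rw [mul_zero] at h2
  filter_upwards [hN, h2.eventually (eventually_lt_nhds hε)] with N hb hlt p hp
  rw [dist_comm, Real.dist_0_eq_abs]
  exact (hb p hp).trans_lt hlt

/-- **`S⁺ → LC_pin`.** -/
theorem latticeComparison_of_rate (h : RateLatticeComparison) : LatticeComparison := by
  obtain ⟨Jr, Jt, Jp, A, hJ, hA, hall⟩ := h
  exact ⟨Jr, Jt, Jp, A, hJ, hA, fun n he hn0 => lcAt_of_rate (hall n he hn0)⟩

/-- `S⁺` feeds `closes` through the registered composition. -/
theorem ProxyUniversality_of_rate (h : RateLatticeComparison) : ProxyUniversality :=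
  ProxyUniversality_of_latticeComparison (latticeComparison_of_rate h)

/-! ## §3 Negation: the limit-free radial hypothesis the dilation test needs -/

/-- **Radial ends-irrelevance (unproved; typed for the census).** For a fixed profile and order `n`:
shifting every point outward by one radial row (`p ↦ e^{δ_N} p`, an exact shift of the `s`-index of
`vertex N`) changes the BARE finite-volume proxy average by `o(ρ_pin(δ_N)^{-n})`-relative amounts,
i.e. the renormalised proxy correlator is asymptotically invariant once the weights are transported.
Radial translation is a symmetry of the couplings but not of the finite path (free ends at
`s = 0, 2(N+1)²`); this is the statement that the ends, `~(N+1)²` rows away, are invisible. -/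
def RadialEndsIrrelevance (Jr Jt Jp : ℕ → ℕ → ℝ) (A : ℕ → ℝ → ℝ) (n : ℕ) : Prop :=
  TendstoLocallyUniformlyOn
    (fun (N : ℕ) (p : Fin n → EuclideanSpace ℝ (Fin 3)) =>
      weight A (fun δ : ℝ => (criticalTwoPoint 3 (Pi.single 0 (⌊1 / δ⌋ : ℤ))) ^ (-(1 / 2 : ℝ))) N n p *
        (proxyAvg Jr Jt Jp N n (fun i => Real.exp (Real.pi / ((N : ℝ) + 1)) • p i) -
          proxyAvg Jr Jt Jp N n p))
    (fun _ => 0) atTop (offAxis n)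

end Summit.CriticalPhenomena.Ising3DConformalLimit.Cruxes.ProxyUniversality.Strategist

end
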